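import Literature.Probability.LatticeModels.ClusterExpansionKPBound
import Literature.Probability.LatticeModels.PolymerGasGeometric
import Literature.Probability.LatticeModels.SharpnessProofs
import HarnessLib

/-!
# The pressure of a translation-invariant polymer gas on `ℤ^d`: thermodynamic limit from the cluster expansion

The "useful consequence" of the Kotecký–Preiss theorem recorded by Kotecký–Preiss themselves
([KP86], p. 493, "translation invariant case") and by Ueltschi (1999, remark after Prop. 2.2),
here in KOTECKÝ–PREISS FORM for NEAREST-NEIGHBOUR-CONNECTED subset polymers: polymers = finite
subsets `A ⊆ ℤ^d` (incompatible iff equal or intersecting), translation-invariant activities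
`ρ(A)` supported on connected sets and small in the sense of KP's hypothesis (1) with
`a = |·|`, `d = δ|·|` at one-site polymers, `Σ_{A ∋ x} |ρ(A)| e^{(1+δ)|A|} ≤ 1`
(`IsSmallTIActivity`; a connected-polymer special case of Ueltschi's remark, whose Prop. 2.2
allows arbitrary, not necessarily connected, finite `A` with `|z(A)| ≤ e^{-τ|A|}`). Then the
finite-volume "free energy" `log Ξ(Λ)` (the Kotecký–Preiss branch `polymerLogZ` of
`ClusterExpansion.lean`; it IS the logarithm of the partition function,
`IsSmallTIActivity.exp_polymerLogZ_powerset`) satisfies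

* `polymerLogZ_powerset_eq_sum_localPolymerPressure`: `log Ξ(Λ) = Σ_{x ∈ Λ} g_Λ(x)` with
  `g_Λ(x) = Σ_{C : clusterSupp C ∋ x, clusterSupp C ⊆ Λ} Φ^T(C)/|clusterSupp C|` (KP (2) plus
  double counting);
* `norm_localPolymerPressure_sub_polymerPressureAt_le`: `|g_Λ(x) - p| ≤ e^{-δ m}` whenever every
  cluster through `x` leaving `Λ` has total size `≥ m`, where the **pressure**
  `p = Σ_{C : clusterSupp C ∋ 0} Φ^T(C)/|clusterSupp C|` (`polymerPressure`, absolutely convergent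
  by [KP86, (4)] at the one-site polymer `{0}`) does not depend on the base point
  (`polymerPressureAt_eq_polymerPressure`);
* `norm_polymerLogZ_box_sub_le`: for the boxes `Λ_L = {-L,…,L}^d`,
  `|log Ξ(Λ_L) - |Λ_L| p| ≤ (2d+1)(2L+1)^{d-1} e^{-2δ}/(1 - e^{-δ})` (clusters through `x`
  escaping the box have `≥ L + 2 - ‖x‖_∞` sites since their support is connected);
* `tendsto_polymerLogZ_box_div_card`: `log Ξ(Λ_L)/|Λ_L| → p`.

The discharge `koteckyPreiss_truncatedWeight_bound_holds` (`ClusterExpansionKPBound.lean`) is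
the only deep input; the rest is the standard bookkeeping ([KP86] p. 493, "one may write down a
closed form expression for the bulk free energy and one has a good control of boundary terms";
Friedli–Velenik §5.7.1). The analytic dependence on parameters (Vitali) is planned for a
sibling file `PolymerPressureAnalytic.lean`. Everything here is PROVED.

## References

* [KP86] R. Kotecký, D. Preiss, Comm. Math. Phys. 103 (1986) 491–498, p. 493 (bulk free energy
  `lim |V|⁻¹ log Z(V) = Σ_{C : clusterSupp C ∋ i} Φ^T(C)/‖C‖`). [KoteckyPreiss1986]
* D. Ueltschi, J. Stat. Phys. 95 (1999) 693, Prop. 2.2 and the remark following it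
  (existence and analyticity of the free energy of a gas of polymers with periodic weights). [Ueltschi1999]
* S. Friedli, Y. Velenik, *Statistical Mechanics of Lattice Systems* (2017), §5.7.1. [FriedliVelenik2017]
-/

noncomputable section

open Finset Filter Topology Set
open scoped BigOperators

namespace Literature.Probability.LatticeModels

/-! ### Subset polymers: the meet-or-equal incompatibility and supports -/

section Subsets

variable {α : Type*} [DecidableEq α]

/-- Incompatibility of subset polymers: equal or intersecting (reflexive also at `∅`).
[cite: KoteckyPreiss1986, §2 (a reflexive and symmetric relation ι)] -/
def polyInc (A B : Finset α) : Prop := A = B ∨ (A ∩ B).Nonempty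

/-- `polyInc` is decidable. [folklore] -/
instance instDecidableRelPolyInc : DecidableRel (polyInc (α := α)) := fun A B => by
  unfold polyInc; infer_instance

/-- `polyInc` is reflexive. [folklore] -/
instance instReflPolyInc : Std.Refl (polyInc (α := α)) := ⟨fun _ => Or.inl rfl⟩

/-- `polyInc` is symmetric. [folklore] -/
instance instSymmPolyInc : Std.Symm (polyInc (α := α)) :=
  ⟨fun A B h => h.elim (fun h => Or.inl h.symm) fun h => Or.inr (by rwa [Finset.inter_comm])⟩

/-- `polyInc` is the geometric incompatibility `GeomInc` of `PolymerGasGeometric.lean` for the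
EMPTY cell adjacency (touching = sharing a cell), so that the Dobrushin-side lemmas of that file
apply to subset polymers. [folklore] -/
theorem polyInc_iff_geomInc (A B : Finset α) : polyInc A B ↔ GeomInc (fun _ _ : α => False) A B := by
  unfold polyInc GeomInc Touches
  refine or_congr Iff.rfl ⟨?_, ?_⟩
  · rintro ⟨x, hx⟩
    exact ⟨x, (Finset.mem_inter.1 hx).1, x, (Finset.mem_inter.1 hx).2, Or.inl rfl⟩
  · rintro ⟨w, hw, q, hq, rfl | h⟩
    · exact ⟨w, Finset.mem_inter.2 ⟨hw, hq⟩⟩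
    · exact h.elim

/-- The support `⋃ C` of a finite family of subset polymers ([KP86] `clusterSupp C`). [cite: KoteckyPreiss1986, p. 493 (clusterSupp C)] -/
def clusterSupp (C : Finset (Finset α)) : Finset α := C.biUnion id

/-- Membership in the support. [folklore] -/
theorem mem_clusterSupp {C : Finset (Finset α)} {x : α} : x ∈ clusterSupp C ↔ ∃ A ∈ C, x ∈ A := by
  unfold clusterSupp
  rw [Finset.mem_biUnion]
  exact Iff.rfl

/-- Members are contained in the support. [folklore] -/
theorem subset_clusterSupp {C : Finset (Finset α)} {A : Finset α} (hA : A ∈ C) : A ⊆ clusterSupp C :=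
  fun _ hx => mem_clusterSupp.2 ⟨A, hA, hx⟩

/-- A family of subsets of `Λ` has support in `Λ`. [folklore] -/
theorem clusterSupp_subset_of_mem_powerset_powerset {C : Finset (Finset α)} {Λ : Finset α}
    (hC : C ∈ Λ.powerset.powerset) : clusterSupp C ⊆ Λ := by
  intro x hx
  obtain ⟨A, hA, hxA⟩ := mem_clusterSupp.1 hx
  exact Finset.mem_powerset.1 ((Finset.mem_powerset.1 hC) hA) hxA

/-- Conversely, a family with support in `Λ` consists of subsets of `Λ`. [folklore] -/
theorem mem_powerset_powerset_of_clusterSupp_subset {C : Finset (Finset α)} {Λ : Finset α}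
    (hC : clusterSupp C ⊆ Λ) : C ∈ Λ.powerset.powerset :=
  Finset.mem_powerset.2 fun _ hA => Finset.mem_powerset.2 ((subset_clusterSupp hA).trans hC)

/-- A family touches the one-site polymer `{x}` iff `x` lies in its support. [folklore] -/
theorem kpTouches_polyInc_singleton_iff {C : Finset (Finset α)} {x : α} :
    KPTouches polyInc C {x} ↔ x ∈ clusterSupp C := by
  rw [mem_clusterSupp]
  constructor
  · rintro ⟨A, hA, h⟩
    rcases h with h | ⟨y, hy⟩
    · exact ⟨A, hA, by rw [h]; exact Finset.mem_singleton_self x⟩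
    · rw [Finset.mem_inter, Finset.mem_singleton] at hy
      exact ⟨A, hA, hy.2 ▸ hy.1⟩
  · rintro ⟨A, hA, hxA⟩
    exact ⟨A, hA, Or.inr ⟨x, Finset.mem_inter.2 ⟨hxA, Finset.mem_singleton_self x⟩⟩⟩

/-- The total size `Σ_{A ∈ C} |A|` of a family dominates the size of its support. [folklore] -/
theorem card_clusterSupp_le_sum_card (C : Finset (Finset α)) : (clusterSupp C).card ≤ ∑ A ∈ C, A.card := by
  unfold clusterSupp
  exact Finset.card_biUnion_le

end Subsets

/-! ### Vanishing of the truncated functional: empty family, a member of zero activity -/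

section TruncatedZero

variable {P : Type*} [DecidableEq P] {inc : P → P → Prop} [DecidableRel inc]

/-- The ray derivative of the empty volume vanishes. [folklore] -/
theorem polymerRayDeriv_empty (w : P → ℂ) (t : ℝ) : polymerRayDeriv inc w ∅ t = 0 := by
  unfold polymerRayDeriv
  rw [Finset.powerset_empty, Finset.filter_singleton]
  split_ifs <;> simp

/-- `log Z(∅) = 0`. [folklore] -/
theorem polymerLogZ_empty (w : P → ℂ) : polymerLogZ inc w ∅ = 0 := by
  unfold polymerLogZ
  simp [polymerRayDeriv_empty]

/-- `Φ^T(∅) = 0`. [folklore] -/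
theorem truncatedWeight_empty (w : P → ℂ) : truncatedWeight inc w ∅ = 0 := by
  unfold truncatedWeight
  rw [Finset.powerset_empty, Finset.sum_singleton]
  simp [polymerLogZ_empty]

/-- If some member of `C` has zero activity then `Φ^T(C) = 0`: removing it does not change any
`log Z(B)`, `B ⊆ C`, and the Möbius transform of a function of `B ∩ (C ∖ δ)` vanishes
(compare [KP86, (11)]). [cite: KoteckyPreiss1986, §3 (11)] -/
theorem truncatedWeight_eq_zero_of_mem_of_eq_zero [Std.Symm inc] {w : P → ℂ} {C : Finset P}
    {δ : P} (hδ : δ ∈ C) (hw : w δ = 0) : truncatedWeight inc w C = 0 := by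
  unfold truncatedWeight
  have hrew : ∀ B ∈ C.powerset, (-1 : ℂ) ^ (C \ B).card * polymerLogZ inc w B =
      (-1 : ℂ) ^ (C \ B).card * polymerLogZ inc w (B ∩ C.erase δ) := by
    intro B hB
    have hBC : B ⊆ C := Finset.mem_powerset.1 hB
    have hint : B ∩ C.erase δ = B.erase δ := by
      ext γ'
      simp only [Finset.mem_inter, Finset.mem_erase]
      constructor
      · rintro ⟨h1, h2, -⟩; exact ⟨h2, h1⟩
      · rintro ⟨h1, h2⟩; exact ⟨h2, h1, hBC h2⟩
    rw [hint, ← polymerLogZ_eq_erase_of_eq_zero hw]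
  rw [Finset.sum_congr rfl hrew]
  exact sum_powerset_neg_one_pow_mul_apply_inter_eq_zero (polymerLogZ inc w)
    (Finset.erase_subset δ C) ⟨δ, Finset.mem_sdiff.2 ⟨hδ, Finset.notMem_erase δ C⟩⟩

end TruncatedZero

section SuppZero

variable {α : Type*} [DecidableEq α]

/-- A family of subset polymers with empty support is `∅` or `{∅}`; if the empty polymer has zero
activity, its truncated functional vanishes. [folklore] -/
theorem truncatedWeight_eq_zero_of_clusterSupp_eq_empty {ρ : Finset α → ℂ} (hρ : ρ ∅ = 0)
    {C : Finset (Finset α)} (hC : clusterSupp C = ∅) : truncatedWeight polyInc ρ C = 0 := by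
  by_cases hCe : C = ∅
  · rw [hCe]; exact truncatedWeight_empty ρ
  · obtain ⟨A, hA⟩ := Finset.nonempty_iff_ne_empty.2 hCe
    have hAe : A = ∅ := by
      rw [← Finset.subset_empty, ← hC]
      exact subset_clusterSupp hA
    subst hAe
    exact truncatedWeight_eq_zero_of_mem_of_eq_zero hA hρ

/-! ### Double counting: `Σ_C f(C) = Σ_x Σ_{C : clusterSupp C ∋ x} f(C)/|clusterSupp C|` -/

/-- **Double counting over the support**: for a function of families of subsets of `Λ` vanishing
on families with empty support,
`Σ_{C} f(C) = Σ_{x ∈ Λ} Σ_{C : x ∈ clusterSupp C} f(C)/|clusterSupp C|` ([KP86], p. 493). [cite: KoteckyPreiss1986, p. 493 (bulk free energy formula)] -/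
theorem sum_powerset_powerset_eq_sum_sum_div (Λ : Finset α) (f : Finset (Finset α) → ℂ)
    (hf : ∀ C ∈ Λ.powerset.powerset, clusterSupp C = ∅ → f C = 0) :
    ∑ C ∈ Λ.powerset.powerset, f C =
      ∑ x ∈ Λ, ∑ C ∈ Λ.powerset.powerset with x ∈ clusterSupp C, f C / ((clusterSupp C).card : ℂ) := by
  symm
  calc ∑ x ∈ Λ, ∑ C ∈ Λ.powerset.powerset with x ∈ clusterSupp C, f C / ((clusterSupp C).card : ℂ)
      = ∑ x ∈ Λ, ∑ C ∈ Λ.powerset.powerset,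
          if x ∈ clusterSupp C then f C / ((clusterSupp C).card : ℂ) else 0 := by
        refine Finset.sum_congr rfl fun x _ => ?_
        rw [Finset.sum_filter]
    _ = ∑ C ∈ Λ.powerset.powerset, ∑ x ∈ Λ,
          if x ∈ clusterSupp C then f C / ((clusterSupp C).card : ℂ) else 0 := Finset.sum_comm
    _ = ∑ C ∈ Λ.powerset.powerset, f C := by
        refine Finset.sum_congr rfl fun C hC => ?_
        rw [Finset.sum_ite_mem, Finset.inter_eq_right.2 (clusterSupp_subset_of_mem_powerset_powerset hC),
          Finset.sum_const, nsmul_eq_mul]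
        by_cases h0 : clusterSupp C = ∅
        · rw [hf C hC h0]; simp
        · have hne : ((clusterSupp C).card : ℂ) ≠ 0 := by
            exact_mod_cast (Finset.card_ne_zero.2 (Finset.nonempty_iff_ne_empty.2 h0))
          field_simp

end SuppZero

/-! ### Small translation-invariant activities on `ℤ^d` and the Kotecký–Preiss input -/

section Zd

variable {d : ℕ}

/-- Translation of a subset polymer of `ℤ^d` by `v`. [folklore] -/
def shiftSet (v : Site d) (A : Finset (Site d)) : Finset (Site d) := A.map (Site.shift v).toEmbedding

/-- `shiftSet v A` is the tree-wide idiom `A.map (Site.shift v).toEmbedding` (definitional).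
[folklore] -/
theorem shiftSet_eq_map (v : Site d) (A : Finset (Site d)) :
    shiftSet v A = A.map (Site.shift v).toEmbedding := rfl

/-- Membership in a translated set. [folklore] -/
theorem mem_shiftSet {v : Site d} {A : Finset (Site d)} {x : Site d} :
    x ∈ shiftSet v A ↔ x - v ∈ A := by
  unfold shiftSet
  rw [Finset.mem_map]
  constructor
  · rintro ⟨y, hy, rfl⟩
    simpa [Site.shift] using hy
  · intro h
    exact ⟨x - v, h, by simp [Site.shift]⟩

/-- The cardinality is translation invariant. [folklore] -/
@[simp] theorem card_shiftSet (v : Site d) (A : Finset (Site d)) : (shiftSet v A).card = A.card :=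
  Finset.card_map _

/-- `shiftSet v` is injective. [folklore] -/
theorem shiftSet_injective (v : Site d) : Function.Injective (shiftSet (d := d) v) :=
  fun _ _ h => Finset.map_injective _ h

/-- Translation preserves the meet-or-equal incompatibility. [folklore] -/
theorem polyInc_shiftSet_iff (v : Site d) (A B : Finset (Site d)) :
    polyInc (shiftSet v A) (shiftSet v B) ↔ polyInc A B := by
  unfold polyInc
  rw [(shiftSet_injective v).eq_iff]
  refine or_congr Iff.rfl ?_
  constructor
  · rintro ⟨x, hx⟩
    rw [Finset.mem_inter, mem_shiftSet, mem_shiftSet] at hx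
    exact ⟨x - v, Finset.mem_inter.2 hx⟩
  · rintro ⟨x, hx⟩
    refine ⟨x + v, ?_⟩
    rw [Finset.mem_inter, mem_shiftSet, mem_shiftSet, add_sub_cancel_right]
    exact Finset.mem_inter.1 hx

/-- **Small translation-invariant activities** on the subset polymers of `ℤ^d`, in
Kotecký–Preiss form: translation invariance, support on nearest-neighbour-connected sets, and
the one-site Kotecký–Preiss smallness (hypothesis (1) of [KP86] with `a = |·|`, `d = δ|·|` at the
polymer `{x}`) `Σ_{A ∋ x} |ρ(A)| e^{(1+δ)|A|} ≤ 1` for every finite family of such `A`, `δ > 0`.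
This is a connected-polymer special case of the hypotheses of Ueltschi's remark after Prop. 2.2
(periodic weights with `|z(A)| ≤ e^{-τ|A|}` for all finite, not necessarily connected, `A`); the
connectivity is used in the boundary estimate `le_sum_card_of_escape`.
[cite: KoteckyPreiss1986, Theorem p. 492, hypothesis (1), and p. 493 (translation invariant case)] -/
structure IsSmallTIActivity (ρ : Finset (Site d) → ℂ) (δ : ℝ) : Prop where
  /-- `ρ(A + v) = ρ(A)`. -/
  shift_invariant : ∀ (v : Site d) (A : Finset (Site d)), ρ (shiftSet v A) = ρ A
  /-- `ρ` lives on connected (in particular nonempty) sets (nearest-neighbour graph of `ℤ^d`). -/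
  eq_zero_of_not_isRConnected : ∀ A, ¬ IsRConnected (zdGraph d).Adj A → ρ A = 0
  /-- the decay rate is positive -/
  delta_pos : 0 < δ
  /-- the one-site Kotecký–Preiss smallness -/
  sum_le_one : ∀ (x : Site d) (𝒜 : Finset (Finset (Site d))), (∀ A ∈ 𝒜, x ∈ A) →
    ∑ A ∈ 𝒜, ‖ρ A‖ * Real.exp ((1 + δ) * A.card) ≤ 1

namespace IsSmallTIActivity

variable {ρ : Finset (Site d) → ℂ} {δ : ℝ}

/-- The empty polymer has zero activity (it is not connected: `IsRConnected` requires
nonemptiness). [folklore] -/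
theorem rho_empty (h : IsSmallTIActivity ρ δ) : ρ ∅ = 0 :=
  h.eq_zero_of_not_isRConnected ∅ fun hc => Finset.not_nonempty_empty hc.1

/-- The Kotecký–Preiss size functions used for subset polymers: `a(A) = |A|`, `d(A) = δ|A|`.
[cite: KoteckyPreiss1986, §2 (choice a(γ), d(γ) proportional to the size)] -/
theorem kp_hypothesis (h : IsSmallTIActivity ρ δ) (γ : Finset (Site d)) :
    Summable (fun γ' : {γ' : Finset (Site d) // polyInc γ' γ} =>
        ‖ρ γ'‖ * Real.exp ((γ' : Finset (Site d)).card + δ * (γ' : Finset (Site d)).card)) ∧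
      ∑' γ' : {γ' : Finset (Site d) // polyInc γ' γ},
        ‖ρ γ'‖ * Real.exp ((γ' : Finset (Site d)).card + δ * (γ' : Finset (Site d)).card) ≤ γ.card := by
  set f : {γ' : Finset (Site d) // polyInc γ' γ} → ℝ := fun γ' =>
    ‖ρ γ'‖ * Real.exp ((γ' : Finset (Site d)).card + δ * (γ' : Finset (Site d)).card) with hf
  have hnn : ∀ x, 0 ≤ f x := fun x => mul_nonneg (norm_nonneg _) (Real.exp_nonneg _)
  -- bound on finite partial sums
  have key : ∀ S : Finset {γ' : Finset (Site d) // polyInc γ' γ}, ∑ x ∈ S, f x ≤ γ.card := by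
    intro S
    -- the finite family of polymers in `S`, without `∅`
    set 𝒜 : Finset (Finset (Site d)) := (S.map (Function.Embedding.subtype _)).filter
      fun A => A.Nonempty with h𝒜
    have hterm : ∀ A : Finset (Site d), ‖ρ A‖ * Real.exp ((A.card : ℝ) + δ * A.card) =
        ‖ρ A‖ * Real.exp ((1 + δ) * A.card) := fun A => by ring_nf
    calc ∑ x ∈ S, f x
        = ∑ A ∈ S.map (Function.Embedding.subtype _), ‖ρ A‖ * Real.exp ((1 + δ) * A.card) := by
          rw [Finset.sum_map]
          exact Finset.sum_congr rfl fun x _ => hterm x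
      _ = ∑ A ∈ 𝒜, ‖ρ A‖ * Real.exp ((1 + δ) * A.card) := by
          rw [h𝒜, Finset.sum_filter]
          refine Finset.sum_congr rfl fun A _ => ?_
          split_ifs with hA
          · rfl
          · rw [Finset.not_nonempty_iff_eq_empty.1 hA, h.rho_empty, norm_zero, zero_mul]
      _ ≤ ∑ x ∈ γ, ∑ A ∈ 𝒜 with x ∈ A, ‖ρ A‖ * Real.exp ((1 + δ) * A.card) := by
          -- every `A ∈ 𝒜` is nonempty and incompatible with `γ`, hence contains a site of `γ`
          have hcover : ∀ A ∈ 𝒜, ∃ x ∈ γ, x ∈ A := by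
            intro A hA
            rw [h𝒜, Finset.mem_filter, Finset.mem_map] at hA
            obtain ⟨⟨y, hy, rfl⟩, hne⟩ := hA
            rcases y.2 with hEq | ⟨x, hx⟩
            · obtain ⟨x, hx⟩ := hne
              exact ⟨x, hEq ▸ hx, hx⟩
            · exact ⟨x, (Finset.mem_inter.1 hx).2, (Finset.mem_inter.1 hx).1⟩
          calc ∑ A ∈ 𝒜, ‖ρ A‖ * Real.exp ((1 + δ) * A.card)
              ≤ ∑ A ∈ 𝒜, ∑ x ∈ γ with x ∈ A, ‖ρ A‖ * Real.exp ((1 + δ) * A.card) := by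
                refine Finset.sum_le_sum fun A hA => ?_
                rw [Finset.sum_const, nsmul_eq_mul]
                obtain ⟨x, hxγ, hxA⟩ := hcover A hA
                have h1 : (1 : ℝ) ≤ (γ.filter fun x => x ∈ A).card := by
                  exact_mod_cast Finset.card_pos.2 ⟨x, Finset.mem_filter.2 ⟨hxγ, hxA⟩⟩
                have h0 : 0 ≤ ‖ρ A‖ * Real.exp ((1 + δ) * A.card) :=
                  mul_nonneg (norm_nonneg _) (Real.exp_nonneg _)
                nlinarith
            _ = ∑ x ∈ γ, ∑ A ∈ 𝒜 with x ∈ A, ‖ρ A‖ * Real.exp ((1 + δ) * A.card) := by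
                rw [Finset.sum_comm' (t' := γ) (s' := fun x => 𝒜.filter fun A => x ∈ A)]
                intro A x
                simp only [Finset.mem_filter]
                tauto
      _ ≤ ∑ _x ∈ γ, (1 : ℝ) := Finset.sum_le_sum fun x _ =>
          h.sum_le_one x _ fun A hA => (Finset.mem_filter.1 hA).2
      _ = γ.card := by simp
  exact ⟨summable_of_sum_le hnn key, Real.tsum_le_of_sum_le hnn key⟩

/-- **The Kotecký–Preiss estimate at a one-site polymer**: under `IsSmallTIActivity`,
`Σ_{C : x ∈ clusterSupp C} |Φ^T(C)| e^{δ‖C‖} ≤ 1` with `‖C‖ = Σ_{A ∈ C} |A|` (from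
`koteckyPreiss_truncatedWeight_bound_holds` with `a(A) = |A|`, `d(A) = δ|A|`, `γ = {x}`).
[cite: KoteckyPreiss1986, Theorem p. 492, estimate (4)] -/
theorem kp_singleton (h : IsSmallTIActivity ρ δ) (x : Site d) :
    Summable (fun C : {C : Finset (Finset (Site d)) // KPTouches polyInc C {x}} =>
        ‖truncatedWeight polyInc ρ C‖ *
          Real.exp (∑ A ∈ (C : Finset (Finset (Site d))), δ * A.card)) ∧
      ∑' C : {C : Finset (Finset (Site d)) // KPTouches polyInc C {x}},
        ‖truncatedWeight polyInc ρ C‖ *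
          Real.exp (∑ A ∈ (C : Finset (Finset (Site d))), δ * A.card) ≤ 1 := by
  have hfact := koteckyPreiss_truncatedWeight_bound_holds polyInc ρ
    (fun A => (A.card : ℝ)) (fun A => δ * A.card) (fun _ => Nat.cast_nonneg _)
    (fun A => mul_nonneg h.delta_pos.le (Nat.cast_nonneg _)) (fun γ => h.kp_hypothesis γ) {x}
  simpa using hfact

end IsSmallTIActivity

/-! ### The pressure and its translation invariance -/

/-- The contribution of the clusters through `x`: `p(x) = Σ_{C : x ∈ clusterSupp C} Φ^T(C)/|clusterSupp C|`
(an absolutely convergent series under `IsSmallTIActivity`). [cite: KoteckyPreiss1986, p. 493 (bulk free energy formula)] -/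
def polymerPressureAt (ρ : Finset (Site d) → ℂ) (x : Site d) : ℂ :=
  ∑' C : {C : Finset (Finset (Site d)) // x ∈ clusterSupp C},
    truncatedWeight polyInc ρ C / ((clusterSupp (C : Finset (Finset (Site d)))).card : ℂ)

/-- **The pressure** (bulk free energy of the polymer gas) `p = Σ_{C : 0 ∈ clusterSupp C} Φ^T(C)/|clusterSupp C|`.
[cite: KoteckyPreiss1986, p. 493 (bulk free energy formula)] -/
def polymerPressure (ρ : Finset (Site d) → ℂ) : ℂ := polymerPressureAt ρ 0

namespace IsSmallTIActivity

variable {ρ : Finset (Site d) → ℂ} {δ : ℝ}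

/-- The subtype of families through `x` in the `KPTouches` form and in the support form are
equivalent. [folklore] -/
def touchesEquiv (x : Site d) :
    {C : Finset (Finset (Site d)) // KPTouches polyInc C {x}} ≃
      {C : Finset (Finset (Site d)) // x ∈ clusterSupp C} :=
  Equiv.subtypeEquivRight fun _ => kpTouches_polyInc_singleton_iff

/-- Summability of `|Φ^T(C)| e^{δ‖C‖}` over the families through `x`, support form. [cite: KoteckyPreiss1986, Theorem p. 492, estimate (4)] -/
theorem summable_norm_mul_exp (h : IsSmallTIActivity ρ δ) (x : Site d) :
    Summable (fun C : {C : Finset (Finset (Site d)) // x ∈ clusterSupp C} =>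
        ‖truncatedWeight polyInc ρ C‖ *
          Real.exp (∑ A ∈ (C : Finset (Finset (Site d))), δ * A.card)) ∧
      ∑' C : {C : Finset (Finset (Site d)) // x ∈ clusterSupp C},
        ‖truncatedWeight polyInc ρ C‖ *
          Real.exp (∑ A ∈ (C : Finset (Finset (Site d))), δ * A.card) ≤ 1 := by
  obtain ⟨hs, hle⟩ := h.kp_singleton x
  set f : {C : Finset (Finset (Site d)) // x ∈ clusterSupp C} → ℝ := fun C =>
    ‖truncatedWeight polyInc ρ C‖ * Real.exp (∑ A ∈ (C : Finset (Finset (Site d))), δ * A.card)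
    with hf
  have hs' : Summable (f ∘ touchesEquiv x) := hs
  refine ⟨(touchesEquiv x).summable_iff.1 hs', ?_⟩
  have heq := (touchesEquiv x).tsum_eq f
  rw [← heq]
  exact hle

/-- The pressure series at `x` converges absolutely (each term is at most `|Φ^T(C)|`).
[cite: KoteckyPreiss1986, p. 493] -/
theorem summable_polymerPressureAt (h : IsSmallTIActivity ρ δ) (x : Site d) :
    Summable fun C : {C : Finset (Finset (Site d)) // x ∈ clusterSupp C} =>
      truncatedWeight polyInc ρ C / ((clusterSupp (C : Finset (Finset (Site d)))).card : ℂ) := by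
  refine Summable.of_norm_bounded (h.summable_norm_mul_exp x).1 fun C => ?_
  rw [norm_div, Complex.norm_natCast]
  have hcard : (1 : ℝ) ≤ (clusterSupp (C : Finset (Finset (Site d)))).card := by
    exact_mod_cast Finset.card_pos.2 ⟨x, C.2⟩
  have h1 : ‖truncatedWeight polyInc ρ C‖ / ((clusterSupp (C : Finset (Finset (Site d)))).card : ℝ) ≤
      ‖truncatedWeight polyInc ρ C‖ := div_le_self (norm_nonneg _) hcard
  refine h1.trans ?_
  exact le_mul_of_one_le_right (norm_nonneg _) (Real.one_le_exp (Finset.sum_nonneg fun A _ =>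
    mul_nonneg h.delta_pos.le (Nat.cast_nonneg _)))

/-- Translating a family of polymers. [folklore] -/
def shiftFamily (v : Site d) (C : Finset (Finset (Site d))) : Finset (Finset (Site d)) :=
  C.map ⟨shiftSet v, shiftSet_injective v⟩

/-- The support of a translated family is the translated support. [folklore] -/
theorem clusterSupp_shiftFamily (v : Site d) (C : Finset (Finset (Site d))) :
    clusterSupp (shiftFamily v C) = shiftSet v (clusterSupp C) := by
  ext y
  simp only [mem_clusterSupp, shiftFamily, Finset.mem_map, Function.Embedding.coeFn_mk, mem_shiftSet]
  constructor
  · rintro ⟨B, ⟨A, hA, rfl⟩, hy⟩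
    exact ⟨A, hA, mem_shiftSet.1 hy⟩
  · rintro ⟨A, hA, hy⟩
    exact ⟨shiftSet v A, ⟨A, hA, rfl⟩, mem_shiftSet.2 hy⟩

/-- The truncated functional is translation invariant for translation-invariant activities
(`truncatedWeight_image`). [folklore] -/
theorem truncatedWeight_shiftFamily (h : IsSmallTIActivity ρ δ) (v : Site d)
    (C : Finset (Finset (Site d))) :
    truncatedWeight polyInc ρ (shiftFamily v C) = truncatedWeight polyInc ρ C := by
  unfold shiftFamily
  rw [Finset.map_eq_image]
  exact truncatedWeight_image (inc := polyInc) (inc' := polyInc)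
    ((shiftSet_injective v).injOn) (fun A _ B _ => polyInc_shiftSet_iff v A B)
    (fun A _ => h.shift_invariant v A)

/-- Composition of translations of sets. [folklore] -/
theorem shiftSet_shiftSet (a b : Site d) (A : Finset (Site d)) :
    shiftSet b (shiftSet a A) = shiftSet (a + b) A := by
  ext y
  simp only [mem_shiftSet]
  rw [show y - (a + b) = y - b - a by abel]

/-- Translation by `0` is the identity on sets. [folklore] -/
theorem shiftSet_zero (A : Finset (Site d)) : shiftSet 0 A = A := by
  ext y; simp [mem_shiftSet]

/-- Composition of translations of families. [folklore] -/
theorem shiftFamily_shiftFamily (a b : Site d) (C : Finset (Finset (Site d))) :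
    shiftFamily b (shiftFamily a C) = shiftFamily (a + b) C := by
  ext B
  simp only [shiftFamily, Finset.mem_map, Function.Embedding.coeFn_mk]
  constructor
  · rintro ⟨A', ⟨A, hA, rfl⟩, rfl⟩
    exact ⟨A, hA, (shiftSet_shiftSet a b A).symm⟩
  · rintro ⟨A, hA, rfl⟩
    exact ⟨shiftSet a A, ⟨A, hA, rfl⟩, shiftSet_shiftSet a b A⟩

/-- Translation of families by `0` is the identity. [folklore] -/
theorem shiftFamily_zero (C : Finset (Finset (Site d))) : shiftFamily 0 C = C := by
  ext B
  simp only [shiftFamily, Finset.mem_map, Function.Embedding.coeFn_mk, shiftSet_zero]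
  constructor
  · rintro ⟨A, hA, rfl⟩; exact hA
  · intro hB; exact ⟨B, hB, rfl⟩

/-- Translation identifies the families through `x` with the families through `y`. [folklore] -/
def shiftSubtypeEquiv (x y : Site d) :
    {C : Finset (Finset (Site d)) // x ∈ clusterSupp C} ≃ {C : Finset (Finset (Site d)) // y ∈ clusterSupp C} where
  toFun C := ⟨shiftFamily (y - x) C.1, by
    rw [clusterSupp_shiftFamily, mem_shiftSet, show y - (y - x) = x by abel]; exact C.2⟩
  invFun C := ⟨shiftFamily (x - y) C.1, by
    rw [clusterSupp_shiftFamily, mem_shiftSet, show x - (x - y) = y by abel]; exact C.2⟩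
  left_inv C := Subtype.ext (by
    simp only [shiftFamily_shiftFamily, show y - x + (x - y) = 0 by abel, shiftFamily_zero])
  right_inv C := Subtype.ext (by
    simp only [shiftFamily_shiftFamily, show x - y + (y - x) = 0 by abel, shiftFamily_zero])

/-- **The pressure does not depend on the base point.** [cite: KoteckyPreiss1986, p. 493 (translation invariant case)] -/
theorem polymerPressureAt_eq_polymerPressure (h : IsSmallTIActivity ρ δ) (x : Site d) :
    polymerPressureAt ρ x = polymerPressure ρ := by
  unfold polymerPressure polymerPressureAt
  rw [← (shiftSubtypeEquiv 0 x).tsum_eq]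
  refine tsum_congr fun C => ?_
  show truncatedWeight polyInc ρ (shiftFamily (x - 0) C.1) /
      ((clusterSupp (shiftFamily (x - 0) C.1)).card : ℂ) = _
  rw [h.truncatedWeight_shiftFamily, clusterSupp_shiftFamily, card_shiftSet]

end IsSmallTIActivity

/-! ### Finite volumes: `log Ξ(Λ) = Σ_{x ∈ Λ} g_Λ(x)` and `|g_Λ(x) - p| ≤ e^{-δ m}` -/

/-- The finite-volume local pressure `g_Λ(x) = Σ_{C : x ∈ clusterSupp C ⊆ Λ} Φ^T(C)/|clusterSupp C|`.
[cite: KoteckyPreiss1986, p. 493 (bulk free energy and boundary terms)] -/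
def localPolymerPressure (ρ : Finset (Site d) → ℂ) (Λ : Finset (Site d)) (x : Site d) : ℂ :=
  ∑ C ∈ Λ.powerset.powerset with x ∈ clusterSupp C,
    truncatedWeight polyInc ρ C / ((clusterSupp C).card : ℂ)

namespace IsSmallTIActivity

variable {ρ : Finset (Site d) → ℂ} {δ : ℝ}

/-- **`log Ξ(Λ) = Σ_{x ∈ Λ} g_Λ(x)`**: the Kotecký–Preiss expansion (2) of the logarithm of the
partition function of the subset polymers of `Λ`, regrouped by double counting over the
supports. [cite: KoteckyPreiss1986, (2) and p. 493] -/
theorem polymerLogZ_powerset_eq_sum_localPolymerPressure (h : IsSmallTIActivity ρ δ) (Λ : Finset (Site d)) :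
    polymerLogZ polyInc ρ Λ.powerset = ∑ x ∈ Λ, localPolymerPressure ρ Λ x := by
  rw [polymerLogZ_eq_sum_truncatedWeight]
  exact sum_powerset_powerset_eq_sum_sum_div Λ _ fun C _ hC =>
    truncatedWeight_eq_zero_of_clusterSupp_eq_empty h.rho_empty hC

/-- **Boundary estimate for the local pressure**: if every family through `x` with non-zero
truncated functional whose support leaves `Λ` has total size `Σ_{A ∈ C} |A| ≥ m`, then
`|g_Λ(x) - p(x)| ≤ e^{-δ m}` (tail of the Kotecký–Preiss estimate (4) at the polymer `{x}`).
[cite: KoteckyPreiss1986, p. 493 ("good control of boundary terms") with estimate (4)] -/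
theorem norm_localPolymerPressure_sub_polymerPressureAt_le (h : IsSmallTIActivity ρ δ) (Λ : Finset (Site d))
    (x : Site d) {m : ℝ}
    (hm : ∀ C : Finset (Finset (Site d)), x ∈ clusterSupp C → ¬ clusterSupp C ⊆ Λ →
      truncatedWeight polyInc ρ C ≠ 0 → m ≤ ∑ A ∈ C, (A.card : ℝ)) :
    ‖localPolymerPressure ρ Λ x - polymerPressureAt ρ x‖ ≤ Real.exp (-δ * m) := by
  -- notation
  set T := {C : Finset (Finset (Site d)) // x ∈ clusterSupp C}
  set g : T → ℂ := fun C => truncatedWeight polyInc ρ C / ((clusterSupp (C : Finset (Finset (Site d)))).card : ℂ)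
    with hg
  set F : T → ℝ := fun C => ‖truncatedWeight polyInc ρ C‖ *
    Real.exp (∑ A ∈ (C : Finset (Finset (Site d))), δ * A.card) with hF
  have hgs : Summable g := h.summable_polymerPressureAt x
  obtain ⟨hFs, hFle⟩ := h.summable_norm_mul_exp x
  have hF0 : ∀ C, 0 ≤ F C := fun C => mul_nonneg (norm_nonneg _) (Real.exp_nonneg _)
  -- the finite part
  set S' : Finset T := (Λ.powerset.powerset.filter fun C => x ∈ clusterSupp C).subtype fun C => x ∈ clusterSupp C
    with hS'
  have hloc : localPolymerPressure ρ Λ x = ∑ C ∈ S', g C := by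
    simp only [hg, hS']
    rw [Finset.sum_subtype_eq_sum_filter (f := fun C : Finset (Finset (Site d)) =>
      truncatedWeight polyInc ρ C / ((clusterSupp C).card : ℂ)), Finset.filter_filter]
    unfold localPolymerPressure
    refine Finset.sum_congr ?_ fun _ _ => rfl
    ext C
    simp only [Finset.mem_filter, and_self]
  have hsplit := hgs.sum_add_tsum_compl (s := S')
  have hdiff : localPolymerPressure ρ Λ x - polymerPressureAt ρ x = -∑' C : ((S' : Set T)ᶜ : Set T), g C := by
    unfold polymerPressureAt
    rw [hloc, ← hsplit]
    ring
  rw [hdiff, norm_neg]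
  -- termwise bound on the complement
  have hterm : ∀ C : ((S' : Set T)ᶜ : Set T), ‖g C‖ ≤ Real.exp (-δ * m) * F C := by
    intro C
    have hxC : x ∈ clusterSupp (C.1 : Finset (Finset (Site d))) := C.1.2
    have hnot : ¬ clusterSupp (C.1 : Finset (Finset (Site d))) ⊆ Λ := fun hsub =>
      C.2 (Finset.mem_coe.2 (Finset.mem_subtype.2
        (Finset.mem_filter.2 ⟨mem_powerset_powerset_of_clusterSupp_subset hsub, hxC⟩)))
    by_cases h0 : truncatedWeight polyInc ρ C.1 = 0
    · simp [hg, hF, h0]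
    · have hmC := hm C.1 hxC hnot h0
      have hcard : (1 : ℝ) ≤ (clusterSupp (C.1 : Finset (Finset (Site d)))).card := by
        exact_mod_cast Finset.card_pos.2 ⟨x, hxC⟩
      calc ‖g C‖ = ‖truncatedWeight polyInc ρ C.1‖ / ((clusterSupp (C.1 : Finset (Finset (Site d)))).card : ℝ) := by
            simp [hg]
        _ ≤ ‖truncatedWeight polyInc ρ C.1‖ := div_le_self (norm_nonneg _) hcard
        _ ≤ ‖truncatedWeight polyInc ρ C.1‖ * Real.exp (δ * ∑ A ∈ (C.1 : Finset (Finset (Site d))), (A.card : ℝ) - δ * m) := by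
            refine le_mul_of_one_le_right (norm_nonneg _) (Real.one_le_exp ?_)
            have := mul_le_mul_of_nonneg_left hmC h.delta_pos.le
            linarith
        _ = Real.exp (-δ * m) * F C := by
            simp only [hF]
            rw [show δ * ∑ A ∈ (C.1 : Finset (Finset (Site d))), (A.card : ℝ) - δ * m =
              (∑ A ∈ (C.1 : Finset (Finset (Site d))), δ * (A.card : ℝ)) + (-δ * m) by
                rw [Finset.mul_sum]; ring, Real.exp_add]
            ring
  -- sum the bounds
  have hFs' : Summable fun C : ((S' : Set T)ᶜ : Set T) => F C :=
    hFs.comp_injective Subtype.val_injective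
  have hns : Summable fun C : ((S' : Set T)ᶜ : Set T) => ‖g C‖ :=
    Summable.of_nonneg_of_le (fun _ => norm_nonneg _) hterm (hFs'.mul_left _)
  calc ‖∑' C : ((S' : Set T)ᶜ : Set T), g C‖ ≤ ∑' C : ((S' : Set T)ᶜ : Set T), ‖g C‖ :=
        norm_tsum_le_tsum_norm hns
    _ ≤ ∑' C : ((S' : Set T)ᶜ : Set T), Real.exp (-δ * m) * F C :=
        hns.tsum_le_tsum hterm (hFs'.mul_left _)
    _ = Real.exp (-δ * m) * ∑' C : ((S' : Set T)ᶜ : Set T), F C := tsum_mul_left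
    _ ≤ Real.exp (-δ * m) * ∑' C : T, F C := by
        refine mul_le_mul_of_nonneg_left ?_ (Real.exp_nonneg _)
        exact tsum_comp_le_tsum_of_inj hFs hF0 Subtype.val_injective
    _ ≤ Real.exp (-δ * m) * 1 := mul_le_mul_of_nonneg_left hFle (Real.exp_nonneg _)
    _ = Real.exp (-δ * m) := mul_one _

/-! ### Geometry: supports of clusters are connected, and large if they escape a box -/

/-- A family with non-zero truncated functional is a Kotecký–Preiss cluster. [cite: KoteckyPreiss1986, Theorem p. 492 (last assertion)] -/
theorem isPolymerCluster_of_ne_zero (h : IsSmallTIActivity ρ δ) {C : Finset (Finset (Site d))}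
    (hC : truncatedWeight polyInc ρ C ≠ 0) : IsPolymerCluster polyInc C := by
  by_contra hCl
  have hKP : IsKPVolume polyInc ρ (fun A : Finset (Site d) => (A.card : ℝ)) C :=
    isKPVolume_of_tsum_le (inc := polyInc) (w := ρ) (a := fun A : Finset (Site d) => (A.card : ℝ))
      (d := fun A : Finset (Site d) => δ * (A.card : ℝ))
      (fun A => mul_nonneg h.delta_pos.le (Nat.cast_nonneg _)) (fun γ => h.kp_hypothesis γ) C
  exact hC (truncatedWeight_eq_zero_of_kp hKP Finset.Subset.rfl hCl)

/-- Every finite volume is a Kotecký–Preiss volume for the size function `a = |·|`.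
[cite: KoteckyPreiss1986, Theorem p. 492, hypothesis (1)] -/
theorem isKPVolume (h : IsSmallTIActivity ρ δ) (𝒱 : Finset (Finset (Site d))) :
    IsKPVolume polyInc ρ (fun A : Finset (Site d) => (A.card : ℝ)) 𝒱 :=
  isKPVolume_of_tsum_le (inc := polyInc) (w := ρ) (a := fun A : Finset (Site d) => (A.card : ℝ))
    (d := fun A : Finset (Site d) => δ * (A.card : ℝ))
    (fun _ => mul_nonneg h.delta_pos.le (Nat.cast_nonneg _)) (fun γ => h.kp_hypothesis γ) 𝒱

/-- **`polymerLogZ` is the logarithm of the partition function**: under `IsSmallTIActivity`,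
`exp (log Ξ(Λ)) = Ξ(Λ) = Σ_{A₁,…,A_k ⊆ Λ disjoint} Π ρ(A_j)` for every finite `Λ ⊆ ℤ^d`
(`exp_polymerLogZ_of_kp` on the Kotecký–Preiss volume `𝒫(Λ)`), so that `polymerPressure` is the
pressure of the polymer gas and not only of the Kotecký–Preiss branch. [cite: KoteckyPreiss1986, Theorem p. 492 (Z ≠ 0 and (2))] -/
theorem exp_polymerLogZ_powerset (h : IsSmallTIActivity ρ δ) (Λ : Finset (Site d)) :
    Complex.exp (polymerLogZ polyInc ρ Λ.powerset) = polymerPartitionFunction polyInc ρ Λ.powerset :=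
  exp_polymerLogZ_of_kp (h.isKPVolume Λ.powerset) Finset.Subset.rfl

/-- Members of a family with non-zero truncated functional have non-zero activity, hence are
connected. [folklore] -/
theorem isRConnected_of_mem_of_ne_zero (h : IsSmallTIActivity ρ δ) {C : Finset (Finset (Site d))}
    (hC : truncatedWeight polyInc ρ C ≠ 0) {A : Finset (Site d)} (hA : A ∈ C) :
    IsRConnected (zdGraph d).Adj A := by
  by_contra hcon
  exact hC (truncatedWeight_eq_zero_of_mem_of_eq_zero hA (h.eq_zero_of_not_isRConnected A hcon))

end IsSmallTIActivity

/-- **Supports of clusters of connected sets are connected**: if `C` is a cluster for the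
meet-or-equal incompatibility and every member is connected, then any two sites of `clusterSupp C` are
joined by a nearest-neighbour path inside `clusterSupp C`. [folklore] -/
theorem reflTransGen_clusterSupp_of_isPolymerCluster {C : Finset (Finset (Site d))}
    (hCl : IsPolymerCluster polyInc C) (hconn : ∀ A ∈ C, IsRConnected (zdGraph d).Adj A)
    {v w : Site d} (hv : v ∈ clusterSupp C) (hw : w ∈ clusterSupp C) :
    Relation.ReflTransGen (fun a b => (zdGraph d).Adj a b ∧ a ∈ clusterSupp C ∧ b ∈ clusterSupp C) v w := by
  classical
  -- the set of sites reachable from `v` inside `clusterSupp C`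
  set R : Site d → Prop := fun u =>
    Relation.ReflTransGen (fun a b => (zdGraph d).Adj a b ∧ a ∈ clusterSupp C ∧ b ∈ clusterSupp C) v u with hR
  -- a connected member meeting the reachable set is entirely reachable
  have hlift : ∀ A ∈ C, ∀ u ∈ A, ∀ u' ∈ A, R u → R u' := by
    intro A hA u hu u' hu' hRu
    have hAs : A ⊆ clusterSupp C := subset_clusterSupp hA
    have hpath := (hconn A hA).2 u hu u' hu'
    have hmono := Relation.ReflTransGen.mono (r := fun a b => (zdGraph d).Adj a b ∧ a ∈ A ∧ b ∈ A)
      (p := fun a b => (zdGraph d).Adj a b ∧ a ∈ clusterSupp C ∧ b ∈ clusterSupp C)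
      fun a b hab => ⟨hab.1, hAs hab.2.1, hAs hab.2.2⟩
    exact hRu.trans (hmono u u' hpath)
  by_contra hvw
  -- `C₁` = members contained in the reachable set
  set C₁ : Finset (Finset (Site d)) := C.filter fun A => ∀ u ∈ A, R u with hC₁
  obtain ⟨A₀, hA₀, hvA₀⟩ := mem_clusterSupp.1 hv
  obtain ⟨A₁, hA₁, hwA₁⟩ := mem_clusterSupp.1 hw
  have hA₀C₁ : A₀ ∈ C₁ := Finset.mem_filter.2 ⟨hA₀, fun u hu => hlift A₀ hA₀ v hvA₀ u hu
    Relation.ReflTransGen.refl⟩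
  have hA₁C₁ : A₁ ∉ C₁ := fun h1 => hvw ((Finset.mem_filter.1 h1).2 w hwA₁)
  obtain ⟨γ₁, hγ₁, γ₂, hγ₂, hinc⟩ := hCl C₁ (Finset.filter_subset _ _) ⟨A₀, hA₀C₁⟩
    ⟨A₁, Finset.mem_sdiff.2 ⟨hA₁, hA₁C₁⟩⟩
  obtain ⟨hγ₂C, hγ₂C₁⟩ := Finset.mem_sdiff.1 hγ₂
  have hγ₁R : ∀ u ∈ γ₁, R u := (Finset.mem_filter.1 hγ₁).2
  rcases hinc with hEq | ⟨u, hu⟩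
  · exact hγ₂C₁ (hEq ▸ hγ₁)
  · obtain ⟨hu₁, hu₂⟩ := Finset.mem_inter.1 hu
    exact hγ₂C₁ (Finset.mem_filter.2 ⟨hγ₂C, fun u' hu' => hlift γ₂ hγ₂C u hu₂ u' hu' (hγ₁R u hu₁)⟩)

/-- The integer sup norm is invariant under negation. DUPLICATE of `Site.supNorm_neg`
(`SharpnessSubcritical.lean`, whose import closure — random currents, GKS — is not wanted here);
to be merged by a librarian move of that lemma next to `Site.supNorm` in `SharpnessProofs.lean`.
[folklore] -/
theorem Site.supNorm_neg' (a : Site d) : Site.supNorm (-a) = Site.supNorm a := by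
  have h := norm_neg a
  rw [Site.norm_eq_supNorm, Site.norm_eq_supNorm] at h
  exact_mod_cast h

/-- A unit coordinate vector has sup norm `1` (equality form of `Site.supNorm_single_one_le` of
`SharpnessSubcritical.lean`; to be merged with it, see `Site.supNorm_neg'`). [folklore] -/
theorem Site.supNorm_single_eq_one (i : Fin d) : Site.supNorm (Pi.single i (1 : ℤ) : Site d) = 1 := by
  apply le_antisymm
  · rw [Site.supNorm_le_iff]
    intro j
    rcases eq_or_ne j i with rfl | hj
    · simp
    · simp [hj]
  · have := Site.natAbs_le_supNorm (Pi.single i (1 : ℤ) : Site d) i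
    simpa using this

/-- Nearest neighbours differ by a vector of sup norm `1`. [folklore] -/
theorem supNorm_sub_eq_one_of_adj {a b : Site d} (hab : (zdGraph d).Adj a b) :
    Site.supNorm (b - a) = 1 := by
  obtain ⟨i, h | h⟩ := (zdGraph_adj_iff a b).1 hab
  · rw [h, add_sub_cancel_left, Site.supNorm_single_eq_one]
  · rw [h, show b - (b + Pi.single i 1) = -(Pi.single i 1 : Site d) by abel, Site.supNorm_neg',
      Site.supNorm_single_eq_one]

/-- Along a nearest-neighbour step the sup-norm distance to any base point changes by at most
one (base-point generalisation of `Site.supNorm_le_succ_of_adj` of `SharpnessSubcritical.lean`;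
to be merged with it, see `Site.supNorm_neg'`). [folklore] -/
theorem Site.supNorm_sub_le_succ_of_adj {a b : Site d} (hab : (zdGraph d).Adj a b) (x : Site d) :
    Site.supNorm (b - x) ≤ Site.supNorm (a - x) + 1 := by
  have h := Site.supNorm_add_le (a - x) (b - a)
  rw [show a - x + (b - a) = b - x by abel, supNorm_sub_eq_one_of_adj hab] at h
  exact h

/-- **Discrete intermediate values**: a set connected by nearest-neighbour steps and containing
`x` and `w` realises every sup-norm distance from `x` up to `‖w - x‖_∞`, hence has at least
`‖w - x‖_∞ + 1` sites. [folklore] -/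
theorem supNorm_sub_lt_card_of_reflTransGen {S : Finset (Site d)} {x w : Site d} (hx : x ∈ S)
    (hw : Relation.ReflTransGen (fun a b => (zdGraph d).Adj a b ∧ a ∈ S ∧ b ∈ S) x w) :
    Site.supNorm (w - x) + 1 ≤ S.card := by
  classical
  -- every level `j ≤ ‖w - x‖` is attained in `S`
  have hlev : ∀ j ≤ Site.supNorm (w - x), ∃ u ∈ S, Site.supNorm (u - x) = j := by
    induction hw with
    | refl =>
      intro j hj
      refine ⟨x, hx, ?_⟩
      simp only [sub_self] at hj ⊢
      have h0 : Site.supNorm (0 : Site d) = 0 := Site.supNorm_eq_zero_iff.2 rfl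
      rw [h0] at hj ⊢
      omega
    | @tail a b _ hab ih =>
      obtain ⟨hadj, -, hbS⟩ := hab
      intro j hj
      by_cases hja : j ≤ Site.supNorm (a - x)
      · exact ih j hja
      · refine ⟨b, hbS, ?_⟩
        have h1 := Site.supNorm_sub_le_succ_of_adj hadj x
        omega
  -- the level map hits `{0, …, ‖w - x‖}`
  have hsub : Finset.range (Site.supNorm (w - x) + 1) ⊆ S.image fun u => Site.supNorm (u - x) := by
    intro j hj
    rw [Finset.mem_range, Nat.lt_succ_iff] at hj
    obtain ⟨u, hu, huj⟩ := hlev j hj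
    exact Finset.mem_image.2 ⟨u, hu, huj⟩
  calc Site.supNorm (w - x) + 1 = (Finset.range (Site.supNorm (w - x) + 1)).card := by simp
    _ ≤ (S.image fun u => Site.supNorm (u - x)).card := Finset.card_le_card hsub
    _ ≤ S.card := Finset.card_image_le

/-- A site outside the box `Λ_L` is at sup-norm distance at least `L + 1 - ‖x‖_∞` from a site
`x` of the box. [folklore] -/
theorem le_supNorm_sub_of_not_mem_box {L : ℕ} (x : Site d) {y : Site d} (hy : y ∉ box d L) :
    L + 1 ≤ Site.supNorm (y - x) + Site.supNorm x := by
  rw [mem_box_iff_supNorm_le] at hy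
  have h := Site.supNorm_add_le (y - x) x
  rw [sub_add_cancel] at h
  omega

namespace IsSmallTIActivity

variable {ρ : Finset (Site d) → ℂ} {δ : ℝ}

/-- **Escaping clusters are large**: a family through `x` with non-zero truncated functional whose
support is not contained in the box `Λ_L` has total size `Σ_{A ∈ C} |A| ≥ L + 2 - ‖x‖_∞`
(truncated subtraction; informative for `x ∈ Λ_L`).
[cite: KoteckyPreiss1986, p. 493 (boundary terms)] -/
theorem le_sum_card_of_escape (h : IsSmallTIActivity ρ δ) {L : ℕ} {x : Site d}
    {C : Finset (Finset (Site d))} (hxC : x ∈ clusterSupp C) (hesc : ¬ clusterSupp C ⊆ box d L)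
    (hC : truncatedWeight polyInc ρ C ≠ 0) :
    ((L + 2 - Site.supNorm x : ℕ) : ℝ) ≤ ∑ A ∈ C, (A.card : ℝ) := by
  obtain ⟨y, hyC, hy⟩ := Finset.not_subset.1 hesc
  have hpath := reflTransGen_clusterSupp_of_isPolymerCluster (h.isPolymerCluster_of_ne_zero hC)
    (fun A hA => h.isRConnected_of_mem_of_ne_zero hC hA) hxC hyC
  have hcard := supNorm_sub_lt_card_of_reflTransGen hxC hpath
  have hdist := le_supNorm_sub_of_not_mem_box x hy
  have hsupp := card_clusterSupp_le_sum_card C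
  have h1 : L + 2 - Site.supNorm x ≤ ∑ A ∈ C, A.card := by omega
  exact_mod_cast h1

end IsSmallTIActivity

/-! ### Boxes: the boundary estimate and the thermodynamic limit -/

/-- The number of sites of `Λ_L` at sup norm exactly `k` is at most `(2d+1)(2L+1)^{d-1}`.
[folklore] -/
theorem card_filter_supNorm_eq_le {L k : ℕ} (hk : k ≤ L) :
    (((box d L).filter fun x => Site.supNorm x = k).card : ℝ) ≤ (2 * d + 1) * (2 * L + 1 : ℝ) ^ (d - 1) := by
  have hset : (box d L).filter (fun x => Site.supNorm x = k) = sphere d k := by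
    ext x
    simp only [Finset.mem_filter, mem_sphere, mem_box_iff_supNorm_le]
    constructor
    · exact fun h => h.2
    · intro h; exact ⟨h ▸ hk, h⟩
  rw [hset]
  have hpow : (1 : ℝ) ≤ (2 * L + 1 : ℝ) ^ (d - 1) := one_le_pow₀ (by linarith)
  rcases k with _ | j
  · -- the sphere of radius `0` is `{0}`
    have h0 : (sphere d 0).card ≤ 1 := by
      rw [Finset.card_le_one]
      intro a ha b hb
      rw [mem_sphere, Site.supNorm_eq_zero_iff] at ha hb
      rw [ha, hb]
    calc ((sphere d 0).card : ℝ) ≤ 1 := by exact_mod_cast h0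
      _ ≤ (2 * d + 1) * (2 * L + 1 : ℝ) ^ (d - 1) := by nlinarith
  · calc ((sphere d (j + 1)).card : ℝ) ≤ 2 * d * (2 * j + 3 : ℝ) ^ (d - 1) := card_sphere_succ_le j
      _ ≤ 2 * d * (2 * L + 1 : ℝ) ^ (d - 1) := by
          refine mul_le_mul_of_nonneg_left (pow_le_pow_left₀ (by positivity) ?_ _) (by positivity)
          have : (j : ℝ) + 1 ≤ L := by exact_mod_cast hk
          linarith
      _ ≤ (2 * d + 1) * (2 * L + 1 : ℝ) ^ (d - 1) := by nlinarith

/-- The boundary sum over a box: `Σ_{x ∈ Λ_L} e^{-δ(L + 2 - ‖x‖_∞)} ≤ (2d+1)(2L+1)^{d-1} e^{-2δ}/(1 - e^{-δ})`.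
[folklore] -/
theorem sum_box_exp_neg_le {δ' : ℝ} (hδ : 0 < δ') (L : ℕ) :
    ∑ x ∈ box d L, Real.exp (-δ' * ((L + 2 - Site.supNorm x : ℕ) : ℝ)) ≤
      (2 * d + 1) * (2 * L + 1 : ℝ) ^ (d - 1) * (Real.exp (-δ') ^ 2 / (1 - Real.exp (-δ'))) := by
  set r : ℝ := Real.exp (-δ') with hr
  have hr0 : 0 ≤ r := Real.exp_nonneg _
  have hr1 : r < 1 := Real.exp_lt_one_iff.2 (by linarith)
  -- group the sites by their sup norm
  have hfib : ∑ x ∈ box d L, Real.exp (-δ' * ((L + 2 - Site.supNorm x : ℕ) : ℝ)) =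
      ∑ k ∈ Finset.range (L + 1), ∑ x ∈ (box d L).filter (fun x => Site.supNorm x = k),
        Real.exp (-δ' * ((L + 2 - Site.supNorm x : ℕ) : ℝ)) := by
    rw [Finset.sum_fiberwise_of_maps_to]
    intro x hx
    rw [Finset.mem_range, Nat.lt_succ_iff, ← mem_box_iff_supNorm_le]
    exact hx
  rw [hfib]
  have hterm : ∀ k ∈ Finset.range (L + 1),
      ∑ x ∈ (box d L).filter (fun x => Site.supNorm x = k),
          Real.exp (-δ' * ((L + 2 - Site.supNorm x : ℕ) : ℝ)) ≤
        (2 * d + 1) * (2 * L + 1 : ℝ) ^ (d - 1) * r ^ (L + 2 - k) := by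
    intro k hk
    rw [Finset.mem_range, Nat.lt_succ_iff] at hk
    have hx : ∀ x ∈ (box d L).filter (fun x => Site.supNorm x = k),
        Real.exp (-δ' * ((L + 2 - Site.supNorm x : ℕ) : ℝ)) = r ^ (L + 2 - k) := by
      intro x hx
      rw [(Finset.mem_filter.1 hx).2, hr, ← Real.exp_nat_mul]
      congr 1
      ring
    rw [Finset.sum_congr rfl hx, Finset.sum_const, nsmul_eq_mul]
    exact mul_le_mul_of_nonneg_right (card_filter_supNorm_eq_le hk) (pow_nonneg hr0 _)
  refine (Finset.sum_le_sum hterm).trans ?_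
  rw [← Finset.mul_sum]
  refine mul_le_mul_of_nonneg_left ?_ (by positivity)
  -- geometric tail: `Σ_{k ≤ L} r^{L+2-k} = r² Σ_{i ≤ L} r^i ≤ r²/(1-r)`
  have hreindex : ∑ k ∈ Finset.range (L + 1), r ^ (L + 2 - k) = r ^ 2 * ∑ i ∈ Finset.range (L + 1), r ^ i := by
    rw [Finset.mul_sum, ← Finset.sum_range_reflect]
    refine Finset.sum_congr rfl fun i hi => ?_
    rw [Finset.mem_range] at hi
    rw [← pow_add]
    congr 1
    omega
  rw [hreindex]
  have hgeom : ∑ i ∈ Finset.range (L + 1), r ^ i ≤ (1 - r)⁻¹ := by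
    rw [← tsum_geometric_of_lt_one hr0 hr1]
    exact (summable_geometric_of_lt_one hr0 hr1).sum_le_tsum _ fun i _ => pow_nonneg hr0 i
  rw [div_eq_mul_inv]
  exact mul_le_mul_of_nonneg_left hgeom (pow_nonneg hr0 2)

namespace IsSmallTIActivity

variable {ρ : Finset (Site d) → ℂ} {δ : ℝ}

/-- **The boundary estimate for boxes**: `|log Ξ(Λ_L) - |Λ_L| p| ≤ (2d+1)(2L+1)^{d-1} e^{-2δ}/(1 - e^{-δ})`.
[cite: KoteckyPreiss1986, p. 493 (bulk free energy and boundary terms)] -/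
theorem norm_polymerLogZ_box_sub_le (h : IsSmallTIActivity ρ δ) (L : ℕ) :
    ‖polymerLogZ polyInc ρ (box d L).powerset - ((box d L).card : ℂ) * polymerPressure ρ‖ ≤
      (2 * d + 1) * (2 * L + 1 : ℝ) ^ (d - 1) * (Real.exp (-δ) ^ 2 / (1 - Real.exp (-δ))) := by
  rw [h.polymerLogZ_powerset_eq_sum_localPolymerPressure, show ((box d L).card : ℂ) * polymerPressure ρ =
    ∑ x ∈ box d L, polymerPressureAt ρ x by
      rw [Finset.sum_congr rfl fun x _ => h.polymerPressureAt_eq_polymerPressure x, Finset.sum_const, nsmul_eq_mul]]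
  rw [← Finset.sum_sub_distrib]
  refine (norm_sum_le _ _).trans ?_
  refine le_trans (Finset.sum_le_sum fun x _ => ?_) (sum_box_exp_neg_le h.delta_pos L)
  have := h.norm_localPolymerPressure_sub_polymerPressureAt_le (box d L) x
    (m := ((L + 2 - Site.supNorm x : ℕ) : ℝ)) fun C hxC hesc hC => h.le_sum_card_of_escape hxC hesc hC
  simpa [neg_mul] using this

/-- **Rate of the thermodynamic limit of the pressure along boxes** ([KP86] p. 493,
translation invariant case; the connected-polymer special case of Ueltschi 1999, remark after
Prop. 2.2): for `d ≥ 1`, `|log Ξ(Λ_L)/|Λ_L| - p| ≤ K/(2L+1)`.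
[cite: KoteckyPreiss1986, p. 493 (bulk free energy and boundary terms, translation invariant case)] -/
theorem norm_polymerLogZ_box_div_card_sub_polymerPressure_le (h : IsSmallTIActivity ρ δ) (hd : 1 ≤ d) (L : ℕ) :
    ‖polymerLogZ polyInc ρ (box d L).powerset / ((box d L).card : ℂ) - polymerPressure ρ‖ ≤
      (2 * d + 1) * (Real.exp (-δ) ^ 2 / (1 - Real.exp (-δ))) / (2 * L + 1 : ℝ) := by
  set K : ℝ := (2 * d + 1) * (Real.exp (-δ) ^ 2 / (1 - Real.exp (-δ))) with hK
  have hcard : ((box d L).card : ℂ) = ((2 * L + 1 : ℝ) : ℂ) ^ d := by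
    rw [card_box]; push_cast; ring
  have h2L : (0 : ℝ) < 2 * L + 1 := by positivity
  have hne : ((box d L).card : ℂ) ≠ 0 := by
    rw [hcard]; exact pow_ne_zero _ (by exact_mod_cast h2L.ne')
  have hnorm : ‖((box d L).card : ℂ)‖ = (2 * L + 1 : ℝ) ^ d := by
    rw [hcard, norm_pow, Complex.norm_real, Real.norm_of_nonneg h2L.le]
  rw [show polymerLogZ polyInc ρ (box d L).powerset / ((box d L).card : ℂ) - polymerPressure ρ =
    (polymerLogZ polyInc ρ (box d L).powerset - ((box d L).card : ℂ) * polymerPressure ρ) /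
      ((box d L).card : ℂ) by field_simp]
  rw [norm_div, hnorm, div_le_div_iff₀ (by positivity) h2L]
  calc ‖polymerLogZ polyInc ρ (box d L).powerset - ((box d L).card : ℂ) * polymerPressure ρ‖ * (2 * L + 1 : ℝ)
      ≤ (2 * d + 1) * (2 * L + 1 : ℝ) ^ (d - 1) * (Real.exp (-δ) ^ 2 / (1 - Real.exp (-δ))) *
          (2 * L + 1 : ℝ) := mul_le_mul_of_nonneg_right (h.norm_polymerLogZ_box_sub_le L) h2L.le
    _ = K * (2 * L + 1 : ℝ) ^ (d - 1 + 1) := by rw [hK, pow_succ]; ring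
    _ = K * (2 * L + 1 : ℝ) ^ d := by rw [Nat.sub_add_cancel hd]

/-- **Thermodynamic limit of the pressure along boxes** ([KP86] p. 493, translation
invariant case; the nearest-neighbour-connected special case of Ueltschi 1999, remark after
Prop. 2.2, "the limit exists"): for `d ≥ 1`, `log Ξ(Λ_L)/|Λ_L| → p` as `L → ∞`.
[cite: KoteckyPreiss1986, p. 493 (translation invariant case)] -/
theorem tendsto_polymerLogZ_box_div_card (h : IsSmallTIActivity ρ δ) (hd : 1 ≤ d) :
    Tendsto (fun L : ℕ => polymerLogZ polyInc ρ (box d L).powerset / ((box d L).card : ℂ))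
      atTop (𝓝 (polymerPressure ρ)) := by
  rw [tendsto_iff_norm_sub_tendsto_zero]
  refine squeeze_zero (fun L => norm_nonneg _)
    (fun L => h.norm_polymerLogZ_box_div_card_sub_polymerPressure_le hd L) ?_
  have h2L : Tendsto (fun L : ℕ => (2 * L + 1 : ℝ)) atTop atTop :=
    tendsto_atTop_add_const_right _ 1 (tendsto_natCast_atTop_atTop.const_mul_atTop two_pos)
  exact tendsto_const_nhds.div_atTop h2L

end IsSmallTIActivity

end Zd

end Literature.Probability.LatticeModels
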